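/- Copyright: the b2b-balaban cell (near-miss cell 7), T⁴-continuum fan-out; row NE7b ROUND-2 swarm, seat
t4-ne7b-formalise-leaf-06 (gen 6) (road W-RP, row W4 file 4d «CUBE SITES»: the sites of a cube cell in W3n's letters;
INTENT journal l.16399 ff.).  Released under the licence of the surrounding project. -/
import Summits.QuantumFields.BalabanUV.T4Continuum.Support.HistoryChessboardEventsCubes
import Summits.QuantumFields.BalabanUV.T4Continuum.Support.HistoryRPTowerColumns

/-!
# Road W-RP, row W4 file 4d: CUBE SITES — the cube cells of file 4c in the column letters of W3n

Summits-side support leaf of the T⁴-continuum cell (rung (B)+1 on a FINITE torus only; NOT infinite volume, NOT the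
mass gap, NOT the Clay statement; NOT a proof of the spine estimate NE7b).  Row NE7b, road **W-RP** (R-OWNER-23-2 ∕
R-OWNER-23-8), row **W4**, file 4d, on top of file 4c (`HistoryChessboardEventsCubes`: `cubeIdx`, `cubeCut`, the two
arithmetic letters `val_sub_cubeCut_lt_half` ∕ `cubeIdx_reflect_cubeCut`) and W3n file 1 (`HistoryRPTowerColumns`, leaf-07
g5: `links`, `slab`, `sref`, `translate_neg_cutVec_mem_posBonds`, `cutBond_mem_links`).  [folklore] finite torus
bookkeeping; DATA defs `cubeOf`, `cubeSites`; no `structure`, no `[cite:]` tag, no `Prop`-valued FACT minted (c1), no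
constant (c2∕c6), no exit ∕ socket ∕ `HistoryConstants` file touched (c3); nothing of W3n restated (imported BY NAME).

WHY.  File 4c runs W4's chessboard on the torus `BlockIdx P.d N` of CUBES of side `M` of the top lattice (`sitesPerDir K =
M·N`), with the RP five at the cube cuts `cubeCut h k`.  W3n supplies, for a set `S` of TOP SITES, the geometry of the
column under `S`: positivity needs `S ⊆ slab K i κ`, reflection maps the column of `S` to the column of `S.image (sref K i
κ)`.  The cube cell `c` enters W3n with `S := cubeSites M c` and `κ := cubeCut h k`; the two facts W3n then asks for are
exactly file 4c's arithmetic letters, lifted from labels to sites here: (SLAB) `c ∈ halfPlus N i k ⇒ cubeSites M c ⊆ slab K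
i (cubeCut h k)`; (REFLECT) `(cubeSites M c).image (sref K i (cubeCut h k)) = cubeSites M (cellReflect i k c)` — W3e's cube
reflection.  Whence, BY NAME from W3n: the links inside a positive cube are positive bonds for the cube cut, and `cutBond`
carries the links inside `c` to the links inside `cellReflect i k c`.

WHAT.  `cubeOf`, `cubeSites` (+ `mem` lemmas); **`cubeSites_subset_slab`**; **`cubeOf_sref`**, **`image_sref_cubeSites`**;
`translate_neg_cutVec_mem_posBonds_of_cube` (W3m-2's `loc` hypothesis for every link inside a cube of the positive half),
`cutBond_mem_links_cube` (the `sym` geometry of cube links).  Remark (not proved here): for `M = L^{m₁}` the cube torus is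
Bałaban's lattice of level `K + m₁` (`sitesPerDir (K + m₁) = N`), `cubeCut` the `m₁`-fold `Site.scaleCoord` and `cubeSites`
the `m₁`-fold `under` of W3n — the cross-cutoff constant form `BlockIdx P₀.d (2·L^{m−m₁})` of file 4c is that lattice up
to file 4a's `castIdx`.

HONEST SCOPE.  Geometry letters only; the column σ-algebra and the `loc`∕`sym` suppliers for column events are W3n file 2
(leaf-07 g5, in flight); which events model Bałaban's terms ((EXT)) and (U1)+(G2) stay displayed; the typing
identification «`blockAvg ℰ` = (0.4)» T-class.  NE7b NOT proved; spine 0∕9.  HONEST DEPENDENCY (cell): continuum YM on T⁴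
⇐ BetaPertH ∧ nine spine estimates (0/9 proved); BetaPertH ⇐ (D1) ∧ (D4) ∧ CAP+tail; G-an2-4 gates asym, D1 and NE2/3/4.
This file changes none of it.
-/

open Finset Literature.Barriers.CriticalPhenomena.NonGibbs
open Literature.MathematicalPhysics.QuantumFieldTheory.Balaban1983to89
open Summit.QuantumFields.BalabanUV.T4Continuum HistoryChessboardEventsSplit HistoryChessboardEventsCubes
open HistoryRPHalfTorus HistoryRPTowerCuts HistoryRPTowerCells HistoryRPTowerColumns

namespace Summit.QuantumFields.BalabanUV.T4Continuum.HistoryChessboardEventsCubeSites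

noncomputable section

variable {P : Params} {M N K : ℕ}

/-! ## §1 Cubes of top sites and the slab of a cube cut -/

/-- **THE CUBE OF A TOP SITE** (cubes of side `M`, `N` per direction): coordinatewise `cubeIdx`. -/
def cubeOf (M N : ℕ) (y : Site P K) : BlockIdx P.d N := fun j => cubeIdx M N (y j)

/-- `cubeOf` coordinatewise. [folklore] -/
@[simp] theorem cubeOf_apply (y : Site P K) (j : Fin P.d) : cubeOf M N y j = cubeIdx M N (y j) := rfl

/-- **THE SITES OF A CUBE** (a set of TOP SITES, W3n's letter `S`). -/
def cubeSites (M : ℕ) (c : BlockIdx P.d N) : Finset (Site P K) := Finset.univ.filter fun y => cubeOf M N y = c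

/-- membership in `cubeSites`. [folklore] -/
@[simp] theorem mem_cubeSites {c : BlockIdx P.d N} {y : Site P K} : y ∈ cubeSites (K := K) M c ↔ cubeOf M N y = c := by
  simp [cubeSites]

variable [NeZero N]

/-- a top site whose cube lies in the positive half `halfPlus N i k` of the cube torus lies in W3n's slab of the cube cut.
[folklore] -/
theorem mem_slab_of_cubeOf_mem (h : P.sitesPerDir K = M * N) {i : Fin P.d} {k : ZMod N} {y : Site P K}
    (hy : cubeOf M N y ∈ halfPlus N i k) : y ∈ slab K i (cubeCut h k) :=
  mem_slab.2 (val_sub_cubeCut_lt_half h (y i) k (by simpa using hy))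

/-- **SLAB**: the sites of a cube of the positive half lie in the positive slab of the cube cut — W3n's hypothesis
`S ⊆ slab K i κ` for `S := cubeSites M c`, `κ := cubeCut h k`. [folklore] -/
theorem cubeSites_subset_slab (h : P.sitesPerDir K = M * N) {i : Fin P.d} {k : ZMod N} {c : BlockIdx P.d N}
    (hc : c ∈ halfPlus N i k) : cubeSites (K := K) M c ⊆ slab K i (cubeCut h k) := fun y hy =>
  mem_slab_of_cubeOf_mem h (by rwa [mem_cubeSites.1 hy])

/-- **W3m-2's `loc` HYPOTHESIS FOR EVERY LINK INSIDE A POSITIVE CUBE** (W3n's `translate_neg_cutVec_mem_posBonds` on the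
slab inclusion). [folklore] -/
theorem translate_neg_cutVec_mem_posBonds_of_cube (h : P.sitesPerDir K = M * N) {i : Fin P.d} {k : ZMod N}
    {c : BlockIdx P.d N} (hc : c ∈ halfPlus N i k) {b : PBond P K} (hb : b ∈ links (cubeSites (K := K) M c)) :
    b.translate (-cutVec K i (cubeCut h k)) ∈ posBonds P K i := by
  rw [mem_links] at hb
  exact translate_neg_cutVec_mem_posBonds i (cubeCut h k) (cubeSites_subset_slab h hc hb.1)
    (cubeSites_subset_slab h hc hb.2)

/-! ## §2 The reflection in a cube cut, on cubes and cube links -/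

/-- **W3n's SITE REFLECTION AT THE CUBE CUT ACTS ON CUBES BY W3e's `cellReflect`.** [folklore] -/
theorem cubeOf_sref (h : P.sitesPerDir K = M * N) (i : Fin P.d) (k : ZMod N) (y : Site P K) :
    cubeOf M N (sref K i (cubeCut h k) y) = cellReflect i k (cubeOf M N y) := by
  funext j
  by_cases hj : j = i
  · subst hj
    rw [cubeOf_apply, sref_apply_same, cellReflect_apply, Function.update_self, cubeIdx_reflect_cubeCut, cubeOf_apply]
  · rw [cubeOf_apply, sref_apply_of_ne i _ y hj, cellReflect_apply, Function.update_of_ne hj, cubeOf_apply]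

/-- **REFLECT**: the sites of a cube are carried by `sref` onto the sites of the reflected cube. [folklore] -/
theorem image_sref_cubeSites (h : P.sitesPerDir K = M * N) (i : Fin P.d) (k : ZMod N) (c : BlockIdx P.d N) :
    (cubeSites (K := K) M c).image (sref K i (cubeCut h k)) = cubeSites M (cellReflect i k c) := by
  ext y
  rw [mem_image_sref_iff, mem_cubeSites, mem_cubeSites, cubeOf_sref]
  constructor
  · intro hy
    rw [← cellReflect_cellReflect i k (cubeOf M N y), hy]
  · intro hy
    rw [hy, cellReflect_cellReflect]

/-- **THE `sym` GEOMETRY OF CUBE LINKS**: `cutBond` at the cube cut carries the links inside the cube `c` to the links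
inside `cellReflect i k c` (W3n's `cutBond_mem_links` + `image_sref_cubeSites`). [folklore] -/
theorem cutBond_mem_links_cube (h : P.sitesPerDir K = M * N) (i : Fin P.d) (k : ZMod N) {c : BlockIdx P.d N}
    {b : PBond P K} (hb : b ∈ links (cubeSites (K := K) M c)) :
    cutBond i (cutVec K i (cubeCut h k)) b ∈ links (cubeSites (K := K) M (cellReflect i k c)) := by
  rw [← image_sref_cubeSites h i k c]
  exact cutBond_mem_links i (cubeCut h k) hb

/-- … and back: `cutBond` is an involution between the two link sets. [folklore] -/
theorem cutBond_mem_links_cube_iff (h : P.sitesPerDir K = M * N) (i : Fin P.d) (k : ZMod N)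
    {c : BlockIdx P.d N} {b : PBond P K} :
    cutBond i (cutVec K i (cubeCut h k)) b ∈ links (cubeSites (K := K) M (cellReflect i k c)) ↔
      b ∈ links (cubeSites (K := K) M c) := by
  constructor
  · intro hb
    have hb' := cutBond_mem_links_cube h i k hb
    rwa [cutBond_cutBond, cellReflect_cellReflect] at hb'
  · exact cutBond_mem_links_cube h i k

end

end Summit.QuantumFields.BalabanUV.T4Continuum.HistoryChessboardEventsCubeSites
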